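import Mathlib
import Summits.ValiantsHypothesis.ValiantsHypothesis.Theorems.BinomialElusiveNumericToPuiseux
import Summits.ValiantsHypothesis.ValiantsHypothesis.Theorems.BinomialElusiveBinomialMapsElusiveComplete

/-!
# Crux `BinomialElusive.BinomialMapsElusive` (stmt-ValiantsHypothesis-7393) — from containment to the
# local dichotomy (packaging)

Puts the pieces together in the vocabulary of the crux: a binomial map `Γ : ℂ^s → ℂ^m`
(`(Γ i).support.card ≤ 2` gives `Γ_i = α_i y^{A_i} + β_i y^{B_i}`, `exists_binomial_decomposition`)
whose image contains a binomial curve `x ↦ (x^{a_i} + x^{b_i})_i` (`a_i < b_i`) has, by the route's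
proved support `numericToPuiseux_proof`, a formal Laurent solution `Γ(p) = (t^{N a_i} + t^{N b_i})_i` at
the place over `x = 0`; and by the complete local classification
(`BinomialMapsElusiveComplete.card_le_of_exactOrder_injective`) such a solution with `s < m` must
have a PURE coordinate value (`β_i p^{B_i} ∈ {t^{N b_i}, t^{N a_i}}`) or a COLLISION of exact orders.
`local_dichotomy_of_range_subset` states exactly this (for every candidate exact-order assignment
`ε` satisfying the five type equations and the purity exclusions, `ε` is not injective).

What remains for the crux (= the binomial case of `PeelingLemma`, stmt-7391): turn a forced
collision into a SHORT integer relation among the `2m` exponents (see the structure note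
`Cruxes/BinomialMapsElusive/STRUCTURE-p1.md`).
-/

-- layout Summits/ValiantsHypothesis/ValiantsHypothesis forces the duplicated namespace component
set_option linter.dupNamespace false

namespace Summit.ValiantsHypothesis.ValiantsHypothesis.Theorems.BinomialMapsElusiveLocalDichotomy

open scoped BigOperators
open Finset
open Summit.ValiantsHypothesis.ValiantsHypothesis.Theorems.BinomialMapsElusiveDeepToric
open Summit.ValiantsHypothesis.ValiantsHypothesis.Theorems.BinomialMapsElusiveComplete

/-- A polynomial with at most two monomials is `monomial A α + monomial B β` for some data
(`β = 0`, `B = A` allowed). -/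
theorem exists_binomial_decomposition {σ R : Type*} [CommSemiring R] (Γ : MvPolynomial σ R)
    (h : Γ.support.card ≤ 2) :
    ∃ (A B : σ →₀ ℕ) (α β : R), Γ = MvPolynomial.monomial A α + MvPolynomial.monomial B β := by
  classical
  have has := MvPolynomial.as_sum Γ
  rcases Nat.lt_or_ge Γ.support.card 2 with hlt | hge
  · rcases Nat.lt_or_ge Γ.support.card 1 with h0 | h1
    · have hs : Γ.support = ∅ := Finset.card_eq_zero.mp (by omega : Γ.support.card = 0)
      refine ⟨0, 0, 0, 0, ?_⟩
      rw [MvPolynomial.support_eq_empty.mp hs]; simp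
    · obtain ⟨A, hA⟩ := Finset.card_eq_one.mp (by omega : Γ.support.card = 1)
      refine ⟨A, A, MvPolynomial.coeff A Γ, 0, ?_⟩
      rw [map_zero, add_zero]
      conv_lhs => rw [has, hA, Finset.sum_singleton]
  · obtain ⟨A, B, hAB, hs⟩ := Finset.card_eq_two.mp (le_antisymm h hge)
    refine ⟨A, B, MvPolynomial.coeff A Γ, MvPolynomial.coeff B Γ, ?_⟩
    conv_lhs => rw [has, hs, Finset.sum_pair hAB]

/-- **From containment to the local dichotomy.**  If a binomial map `Γ = (α_i y^{A_i} + β_i y^{B_i})_i :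
ℂ^s → ℂ^m`, `s < m`, has image containing the binomial curve `x ↦ (x^{a_i} + x^{b_i})_i`
(`a_i < b_i`), then there are `N ≥ 1` and Laurent series `p` with `Γ_i(p) = t^{N a_i} + t^{N b_i}`,
and for this solution every exact-order assignment `ε` compatible with the five local types
(honest-A / cancelling / honest-B / pure tie / tie, see `BinomialMapsElusiveComplete`) and with
no pure coordinate value fails to be injective: some exact orders COLLIDE. -/
theorem local_dichotomy_of_range_subset {m s : ℕ} (hs : s < m)
    (Γ : Fin m → MvPolynomial (Fin s) ℂ) (A B : Fin m → Fin s →₀ ℕ) (α β : Fin m → ℂ)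
    (hΓ : ∀ i, Γ i = MvPolynomial.monomial (A i) (α i) + MvPolynomial.monomial (B i) (β i))
    (a b : Fin m → ℕ) (hab : ∀ i, a i < b i)
    (hsub : Set.range (fun x : ℂ => fun i : Fin m => x ^ a i + x ^ b i) ⊆
      Set.range (fun y : Fin s → ℂ => fun i : Fin m => MvPolynomial.eval y (Γ i))) :
    ∃ (N : ℕ) (p : Fin s → LaurentSeries ℂ), 0 < N ∧
      (∀ i, MvPolynomial.aeval p (Γ i) =
        HahnSeries.single ((N * a i : ℕ) : ℤ) 1 + HahnSeries.single ((N * b i : ℕ) : ℤ) 1) ∧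
      ∀ ε : Fin m → WithTop ℤ,
        (∀ i, (MvPolynomial.aeval p (MvPolynomial.monomial (B i) (β i)) = 0 ∨
            (((N * a i : ℕ) : ℤ) : WithTop ℤ) <
              (MvPolynomial.aeval p (MvPolynomial.monomial (B i) (β i))).orderTop) →
          MvPolynomial.aeval p (MvPolynomial.monomial (B i) (β i)) ≠
            HahnSeries.single ((N * b i : ℕ) : ℤ) 1 ∧
          ε i = (HahnSeries.single (((N * b i : ℕ) : ℤ) - ((N * a i : ℕ) : ℤ)) (1 : ℂ) -
            HahnSeries.single (-((N * a i : ℕ) : ℤ)) 1 *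
              MvPolynomial.aeval p (MvPolynomial.monomial (B i) (β i))).orderTop) →
        (∀ i, (MvPolynomial.aeval p (MvPolynomial.monomial (B i) (β i))).orderTop <
            (((N * a i : ℕ) : ℤ) : WithTop ℤ) →
          ε i = ((HahnSeries.single ((N * a i : ℕ) : ℤ) (1 : ℂ) +
            HahnSeries.single ((N * b i : ℕ) : ℤ) 1) *
            (MvPolynomial.aeval p (MvPolynomial.monomial (B i) (β i)))⁻¹).orderTop) →
        (∀ i, (MvPolynomial.aeval p (MvPolynomial.monomial (B i) (β i))).orderTop =
            (((N * a i : ℕ) : ℤ) : WithTop ℤ) →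
          (MvPolynomial.aeval p (MvPolynomial.monomial (B i) (β i))).leadingCoeff = 1 →
          MvPolynomial.aeval p (MvPolynomial.monomial (B i) (β i)) ≠
            HahnSeries.single ((N * a i : ℕ) : ℤ) 1 ∧
          ε i = (HahnSeries.single (((N * b i : ℕ) : ℤ) - ((N * a i : ℕ) : ℤ)) (1 : ℂ) -
            HahnSeries.single (-((N * a i : ℕ) : ℤ)) 1 *
              MvPolynomial.aeval p (MvPolynomial.monomial (A i) (α i))).orderTop) →
        (∀ i, (MvPolynomial.aeval p (MvPolynomial.monomial (B i) (β i))).orderTop =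
            (((N * a i : ℕ) : ℤ) : WithTop ℤ) →
          (MvPolynomial.aeval p (MvPolynomial.monomial (B i) (β i))).leadingCoeff ≠ 1 →
          MvPolynomial.aeval p (MvPolynomial.monomial (B i) (β i)) =
            HahnSeries.single ((N * a i : ℕ) : ℤ)
              (MvPolynomial.aeval p (MvPolynomial.monomial (B i) (β i))).leadingCoeff →
          ε i = (((N * b i : ℕ) : ℤ) - ((N * a i : ℕ) : ℤ) : ℤ)) →
        (∀ i, (MvPolynomial.aeval p (MvPolynomial.monomial (B i) (β i))).orderTop =
            (((N * a i : ℕ) : ℤ) : WithTop ℤ) →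
          (MvPolynomial.aeval p (MvPolynomial.monomial (B i) (β i))).leadingCoeff ≠ 1 →
          MvPolynomial.aeval p (MvPolynomial.monomial (B i) (β i)) ≠
            HahnSeries.single ((N * a i : ℕ) : ℤ)
              (MvPolynomial.aeval p (MvPolynomial.monomial (B i) (β i))).leadingCoeff →
          ε i = (HahnSeries.single (-((N * a i : ℕ) : ℤ))
              (MvPolynomial.aeval p (MvPolynomial.monomial (B i) (β i))).leadingCoeff⁻¹ *
            MvPolynomial.aeval p (MvPolynomial.monomial (B i) (β i)) - 1).orderTop) →
        ¬ Function.Injective ε := by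
  have hm : 0 < m := lt_of_le_of_lt (Nat.zero_le s) hs
  obtain ⟨N, p, hN, hp⟩ := Summit.ValiantsHypothesis.Theorems.numericToPuiseux_proof m s a b Γ hm hsub
  refine ⟨N, p, hN, hp, fun ε hA hC hB hP hT hinj => ?_⟩
  have hg0 : ∀ i, (0 : ℤ) < ((N * b i : ℕ) : ℤ) - ((N * a i : ℕ) : ℤ) := fun i => by
    have : N * a i < N * b i := Nat.mul_lt_mul_of_pos_left (hab i) hN
    omega
  have heg : ∀ i, ((N * a i : ℕ) : ℤ) + (((N * b i : ℕ) : ℤ) - ((N * a i : ℕ) : ℤ)) = ((N * b i : ℕ) : ℤ) :=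
    fun i => by ring
  have key := card_le_of_exactOrder_injective (σ := Fin s) (ι := Fin m) p
    (fun i j => A i j) (fun i j => B i j) α β (fun i => ((N * a i : ℕ) : ℤ))
    (fun i => ((N * b i : ℕ) : ℤ) - ((N * a i : ℕ) : ℤ)) hg0
    (fun i => by
      rw [← aeval_monomial_eq_smul_prod, ← aeval_monomial_eq_smul_prod, ← map_add, ← hΓ, hp i, heg])
    ε
    (fun i h => by
      rw [← aeval_monomial_eq_smul_prod] at h ⊢; rw [heg]; exact hA i h)
    (fun i h => by
      rw [← aeval_monomial_eq_smul_prod] at h ⊢; rw [heg]; exact hC i h)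
    (fun i h1 h2 => by
      rw [← aeval_monomial_eq_smul_prod] at h1 h2 ⊢; rw [← aeval_monomial_eq_smul_prod]
      exact hB i h1 h2)
    (fun i h1 h2 h3 => by
      rw [← aeval_monomial_eq_smul_prod] at h1 h2 h3; exact hP i h1 h2 h3)
    (fun i h1 h2 h3 => by
      rw [← aeval_monomial_eq_smul_prod] at h1 h2 h3 ⊢; exact hT i h1 h2 h3)
    hinj
  simp only [Fintype.card_fin] at key
  omega

end Summit.ValiantsHypothesis.ValiantsHypothesis.Theorems.BinomialMapsElusiveLocalDichotomy
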